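import Summits.QuantumFields.YangMills.Theorems.WeakCouplingRatesBulkDominatesColdBoxWKernelGoodEvent
import Summits.QuantumFields.YangMills.Theorems.WeakCouplingRatesColdBoxMeanBookkeeping
import Summits.QuantumFields.YangMills.Theorems.WeakCouplingRatesColdBoxDirichletShiftedMean
import Summits.QuantumFields.YangMills.Theorems.WeakCouplingRatesBulkDominatesColdBoxWDlrPlumbing

/-!
# Crux `BulkDominatesColdBoxW` (stmt-QuantumFields-19609), stub `stub_kernelMeanExpansion`: the MEAN chain ASSEMBLED at fixed `β` — a deterministic
# bound on `|β·E_{γ(·|ω)}[c_q] − (3/2)·V_D − ½Σ_c F_c²|` from a representation hypothesis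

The mean twin of `abs_boxPlaqCov_sub_dirCircSqCov_le_core` (`Theorems/WeakCouplingRatesColdBoxDominationCore.lean`, seat `ym-wcr-19456-p1`), written
ABSTRACTLY in the trunk objects so that the datum pass instantiates it by `exact`: for the box kernel `μ = boxKernel β H ω`, a measurable event `G`
of configurations with `μ(G) ≠ 0`, `μ(Gᶜ) ≤ p_Y` (YM large fields, `boxKernel_real_coldGoodSet_compl_le`), a chart map `cfg` on the three-colour space,
a measurable event `S` there with `D^{⊗3}(S) ≠ 0`, `D^{⊗3}(Sᶜ) ≤ p` (`measureReal_pi_not_shiftedSmallField_le`), a measurable tilt `W` with `|𝟙_S W| ≤ w`,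
and the REPRESENTATION `∫ βc_q dμ[|G] = ∫ βc_q∘cfg d((D^{⊗3}[|S]).tilted (𝟙_S W))` (trunk, T3 with datum), plus on `S` the surrogate bound
`|βc_q(cfg t) − ½Σ_c (F_c + X_{q'}(t_c))²| ≤ τ` (chart, R3) and `0 ≤ βc_q∘cfg ≤ M`:

  **`abs_kernelMean_sub_gaussian_le_core`**:
  `|β·E_μ[c_q] − ((3/2)·V_D(q') + ½Σ_c F_c²)| ≤ 2M·p_Y + M(e^{2w} − 1) + 2M·p + τ + √p·√(6Σ_c(F_c⁴ + 3V_D(q')²))`.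

Chain: YM conditioning (`abs_integral_sub_integral_cond_le`), representation, mean bookkeeping (`abs_integral_tilted_cond_sub_integral_le`), exact
Gaussian value and second moment (`integral_quadObs_pi_eq`, `integral_quadObs_sq_pi_le`).  The exponent bookkeeping (`M = 4β`, `p_Y = e^{−β^ε}`, …
`⇒ ≤ β^{−θ}`) is left to the assembler (`Theorems/WeakCouplingRatesEventuallyPow.lean`).

Fleet seat `ym-spine-20043-p1` (g3; «A-mean twin», critic STUB-PLAN rev 2).  No sorry, standard axioms, no new definition, no named-fact hypothesis.
NOT a claim about the mass gap.
-/

set_option autoImplicit false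

noncomputable section

open MeasureTheory ProbabilityTheory Finset Real
open Literature.Probability.LatticeModels
open Literature.MathematicalPhysics.QuantumLattice
open Literature.MathematicalPhysics.QuantumFieldTheory
open Literature.MathematicalPhysics.QuantumFieldTheory.LatticeMaxwell
open Literature.MathematicalPhysics.QuantumFieldTheory.AxialGauge

namespace Summit.QuantumFields.YangMills.Theorems.WeakCouplingRates

set_option maxHeartbeats 400000 in
/-- **The mean chain at fixed `β` (abstract trunk objects).**  See the module docstring. -/
theorem abs_kernelMean_sub_gaussian_le_core {H : ℕ} {β : ℝ} (ω : LGConfig 4 (Matrix.specialUnitaryGroup (Fin 2) ℂ))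
    (x : Site 4) (i j : Fin 4)
    -- YM side: the good event of configurations
    {G : Set (LGConfig 4 (Matrix.specialUnitaryGroup (Fin 2) ℂ))} (hG : MeasurableSet G) (hG0 : boxKernel β H ω G ≠ 0)
    {pY : ℝ} (hpY : (boxKernel β H ω).real Gᶜ ≤ pY)
    {M : ℝ} (hM : 0 ≤ M) (hfM : ∀ U, |β * plaqCostAt (fundamentalRep (Fin 2)) x i j U| ≤ M)
    -- Gaussian side: chart map, small-field event, tilt
    (cfg : (Fin 3 → EuclideanSpace ℝ (DirFree H)) → LGConfig 4 (Matrix.specialUnitaryGroup (Fin 2) ℂ)) (hcfg : Measurable cfg)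
    {S : Set (Fin 3 → EuclideanSpace ℝ (DirFree H))} (hS : MeasurableSet S) (hS0 : (Measure.pi fun _ : Fin 3 => boxDirichlet H) S ≠ 0)
    {p : ℝ} (hp : (Measure.pi fun _ : Fin 3 => boxDirichlet H).real Sᶜ ≤ p)
    {W : (Fin 3 → EuclideanSpace ℝ (DirFree H)) → ℝ} (hWm : Measurable W) {w : ℝ} (hW : ∀ t, |S.indicator W t| ≤ w)
    -- the representation (trunk) and the surrogate (chart) on `S`
    (hRep : ∫ U, β * plaqCostAt (fundamentalRep (Fin 2)) x i j U ∂((boxKernel β H ω)[|G]) =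
      ∫ t, β * plaqCostAt (fundamentalRep (Fin 2)) x i j (cfg t)
        ∂(((Measure.pi fun _ : Fin 3 => boxDirichlet H)[|S]).tilted (S.indicator W)))
    (F : Fin 3 → ℝ) (q' : Plaq 4) {τ : ℝ}
    (hFS : ∀ t ∈ S, 0 ≤ β * plaqCostAt (fundamentalRep (Fin 2)) x i j (cfg t) ∧ β * plaqCostAt (fundamentalRep (Fin 2)) x i j (cfg t) ≤ M)
    (hSur : ∀ t ∈ S, |β * plaqCostAt (fundamentalRep (Fin 2)) x i j (cfg t) - (1 / 2 : ℝ) * ∑ c, (F c + dirCirc H q' (t c)) ^ 2| ≤ τ) :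
    |β * (∫ U, plaqCostAt (fundamentalRep (Fin 2)) x i j U ∂(boxKernel β H ω)) -
        (3 / 2 * boxDirProjKernel H q' q' + 1 / 2 * ∑ c, F c ^ 2)| ≤
      2 * M * pY + M * (Real.exp (2 * w) - 1) + 2 * M * p + τ +
        Real.sqrt p * Real.sqrt (6 * ∑ c, (F c ^ 4 + 3 * boxDirProjKernel H q' q' ^ 2)) := by
  haveI : IsProbabilityMeasure (boxKernel β H ω) := isProbabilityMeasure_boxKernel β H ω
  have hfm : Measurable (fun U => β * plaqCostAt (fundamentalRep (Fin 2)) x i j U) :=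
    measurable_const.mul (measurable_plaqCostAt x i j)
  have hfi : Integrable (fun U => β * plaqCostAt (fundamentalRep (Fin 2)) x i j U) (boxKernel β H ω) :=
    integrable_of_bound hfm.aestronglyMeasurable hfM
  -- (1) YM conditioning
  have h1 : |(∫ U, β * plaqCostAt (fundamentalRep (Fin 2)) x i j U ∂(boxKernel β H ω)) -
      ∫ U, β * plaqCostAt (fundamentalRep (Fin 2)) x i j U ∂((boxKernel β H ω)[|G])| ≤ 2 * M * pY := by
    have key := abs_integral_sub_integral_cond_le (μ := boxKernel β H ω) hG hG0 hfi hfM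
    have h2M : 0 ≤ 2 * M := by linarith
    exact key.trans (mul_le_mul_of_nonneg_left hpY h2M)
  -- (2)+(3) representation and mean bookkeeping on the Gaussian side
  have hQ2 : MemLp (fun t : Fin 3 → EuclideanSpace ℝ (DirFree H) => (1 / 2 : ℝ) * ∑ c, (F c + dirCirc H q' (t c)) ^ 2) 2
      (Measure.pi fun _ : Fin 3 => boxDirichlet H) := memLp_two_quadObs_pi F q'
  have hnn : 0 ≤ 6 * ∑ c, (F c ^ 4 + 3 * boxDirProjKernel H q' q' ^ 2) :=
    mul_nonneg (by norm_num) (Finset.sum_nonneg fun c _ => by positivity)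
  have hK0 : 0 ≤ Real.sqrt (6 * ∑ c, (F c ^ 4 + 3 * boxDirProjKernel H q' q' ^ 2)) := Real.sqrt_nonneg _
  have hKQ : ∫ t, ((1 / 2 : ℝ) * ∑ c, (F c + dirCirc H q' (t c)) ^ 2) ^ 2 ∂(Measure.pi fun _ : Fin 3 => boxDirichlet H) ≤
      Real.sqrt (6 * ∑ c, (F c ^ 4 + 3 * boxDirProjKernel H q' q' ^ 2)) ^ 2 := by
    rw [Real.sq_sqrt hnn]
    exact integral_quadObs_sq_pi_le (H := H) F q'
  have hFm : Measurable fun t : Fin 3 → EuclideanSpace ℝ (DirFree H) => β * plaqCostAt (fundamentalRep (Fin 2)) x i j (cfg t) :=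
    hfm.comp hcfg
  have h3 := abs_integral_tilted_cond_sub_integral_le (γ := Measure.pi fun _ : Fin 3 => boxDirichlet H) hS hS0 hWm hW
    (F := fun t => β * plaqCostAt (fundamentalRep (Fin 2)) x i j (cfg t))
    (Q := fun t => (1 / 2 : ℝ) * ∑ c, (F c + dirCirc H q' (t c)) ^ 2) hFm hQ2 hM hK0 hFS hSur hp hKQ
  -- (4) the exact Gaussian value
  have h4 : ∫ t, (1 / 2 : ℝ) * ∑ c, (F c + dirCirc H q' (t c)) ^ 2 ∂(Measure.pi fun _ : Fin 3 => boxDirichlet H) =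
      3 / 2 * boxDirProjKernel H q' q' + 1 / 2 * ∑ c, F c ^ 2 := integral_quadObs_pi_eq F q'
  -- assemble
  rw [← integral_const_mul, ← h4]
  rw [hRep] at h1
  calc |(∫ U, β * plaqCostAt (fundamentalRep (Fin 2)) x i j U ∂(boxKernel β H ω)) -
          ∫ t, (1 / 2 : ℝ) * ∑ c, (F c + dirCirc H q' (t c)) ^ 2 ∂(Measure.pi fun _ : Fin 3 => boxDirichlet H)|
      ≤ |(∫ U, β * plaqCostAt (fundamentalRep (Fin 2)) x i j U ∂(boxKernel β H ω)) -
            ∫ t, β * plaqCostAt (fundamentalRep (Fin 2)) x i j (cfg t)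
              ∂(((Measure.pi fun _ : Fin 3 => boxDirichlet H)[|S]).tilted (S.indicator W))| +
          |(∫ t, β * plaqCostAt (fundamentalRep (Fin 2)) x i j (cfg t)
              ∂(((Measure.pi fun _ : Fin 3 => boxDirichlet H)[|S]).tilted (S.indicator W))) -
            ∫ t, (1 / 2 : ℝ) * ∑ c, (F c + dirCirc H q' (t c)) ^ 2 ∂(Measure.pi fun _ : Fin 3 => boxDirichlet H)| :=
        abs_sub_le _ _ _
    _ ≤ 2 * M * pY + (M * (Real.exp (2 * w) - 1) + 2 * M * p + τ +
          Real.sqrt p * Real.sqrt (6 * ∑ c, (F c ^ 4 + 3 * boxDirProjKernel H q' q' ^ 2))) := add_le_add h1 h3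
    _ = _ := by ring

end Summit.QuantumFields.YangMills.Theorems.WeakCouplingRates

end
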